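import Literature.NumberTheory.Automorphic.GodementJacquetZetaIntegrals
import Literature.NumberTheory.Automorphic.AdelicTruncation
import Literature.NumberTheory.Automorphic.UnramifiedHeckeScalarsProofs
import Literature.NumberTheory.Automorphic.StrongApproximationGL2
import Mathlib.Analysis.Normed.Ring.Units
import Mathlib.Topology.Instances.Matrix
import Mathlib.Analysis.Calculus.BumpFunction.FiniteDimension
import Mathlib.Analysis.Calculus.ParametricIntegral
import Mathlib.Analysis.SpecialFunctions.Pow.Deriv
import Literature.NumberTheory.Automorphic.GLnAdelicStructureProofs
import Literature.NumberTheory.Automorphic.GJUnfoldingIntegral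

/-!
# Data for the `K^T`-spherical unfolding: product neighbourhoods, the congruence box, the test
function `Φ = Φ_∞ ⊗ 1_{B(𝔫)}` and the local zeta integral over `G_T`

Topic `NumberTheory/Automorphic`; namespace `Literature.NumberTheory.Automorphic`. Fifth brick of the
discharge of `GodementJacquet1972_gjZeta_eulerFactorisation` (Godement–Jacquet, LNM 260, Thm. 13.8
(proof): `Z(Φ, s, φ, φ̃) = ∏_v Z_v` with unramified factors `L(s - (n-1)/2, Π_w)` and the remaining
local integrals entire and non-vanishing at a point, Thm. 3.3 / Thm. 8.7), after `GJUnfoldingLocal`,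
`GJUnfoldingCosets`, `CosetIntegral`, `GJUnfoldingIntegral`. The previous file reduced the global
integral for `dh ⊗ da` on `GL_n(𝔸_K) = H^T · G_T` to
`vol(K^T) · L^T · ∫_{G_T} Φ_G(a) ⟪φ', R(a) φ⟫ |det a|^s da` under three hypotheses on the test
function (`hΦ`: factorisation `Φ(h a) = 1_{Δ^T}(h) Φ_G(a)`, `hΦc`: continuity on `GL_n(𝔸_K)`,
`hΦG`: absolute convergence on `G_T`). This file constructs test functions satisfying them and
controls the remaining integral over `G_T`:

* **Product neighbourhoods** (`exists_isOpen_level_subset`): every neighbourhood of `1` in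
  `GL_n(𝔸_K)` contains `{g | g_∞ ∈ V, (1, g_f) ∈ K(𝔫)}` for an open `V ∋ 1` of
  `M_n(ℝ^{r₁} × ℂ^{r₂})` and a level `𝔫 ≠ 0` (the units topology of `GL_n` over the Banach algebra
  `M_n(ℝ^{r₁} × ℂ^{r₂})` is the norm topology, `isEmbedding_val_generalLinearGroup_mixedSpace`, via
  Mathlib `Units.isEmbedding_val_mk'`; and `exists_principalCongruenceLevel_subset`).
* **The congruence box** `finiteBox n K 𝔫 = ∏_{w ∣ 𝔫} (1 + 𝔫 M_n(𝒪_w)) × ∏_{w ∤ 𝔫} M_n(𝒪_w) ⊆ M_n(𝔸_K^∞)`: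
  compact open (`isOpen_finiteBox`, `isCompact_finiteBox`), so its indicator is Schwartz–Bruhat
  (`indicator_finiteBox_mem_schwartzBruhat`); along `H^T × G_T`, `T = T(𝔫)` the primes of `𝔫`
  (`primesOf`), membership of `(h a)_f` splits as `h ∈ Δ^T ∧ a ∈ ∏_{w ∣ 𝔫}(1 + 𝔫 M_n(𝒪_w))`
  (`adelicMatrixFinite_mul_mem_finiteBox_iff`, `InLocalBoxes`); an integral matrix `≡ 1 (mod 𝔪)`,
  `𝔪 ≠ 𝒪`, has integral inverse (`mem_valuedCongruenceSubgroup_of_valued_le`, ultrametric maximum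
  argument), whence such `a` have finite part in `K(𝔫)` (`ofFinite_sndHom_mem_principalCongruenceLevel`).
* **The test function** `gjTestFunction n K Φ_∞ 𝔫 = Φ_∞ ⊗ 1_{B(𝔫)} ∈ 𝒮(M_n(𝔸_K))`
  (`gjTestFunction_mem`), its `G_T`-part `gjTestFunctionG` (`Φ_G(a) = Φ_∞(a_∞) 1[a ∈ boxes]`), the
  factorisation `hΦ` (`gjTestFunction_mul`), continuity `hΦc` (`continuous_gjTestFunction`), and an
  archimedean bump `Φ_∞` with values in `[0,1]`, `Φ_∞(1) = 1`, supported in a given open `V ∋ 1`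
  (`exists_schwartz_bump_mixedSpace`: Mathlib `ContDiffBump` and `HasCompactSupport.toSchwartzMap`).
* **The data adapted to `φ`** (`exists_unfolding_data`): for `φ ≠ 0` of level `K(𝔫₀)` and a finite
  `S`, a level `𝔫 ≤ 𝔫₀` with `T(𝔫) ⊇ S ∪ T(𝔫₀)` (so `φ` is `K^T`-fixed,
  `awayLevel_le_principalCongruenceLevel`), a bump `Φ_∞` and a compact `N` such that `Φ_G(a) ≠ 0`
  forces `a ∈ N` and `‖R(a) φ - φ‖ < ‖φ‖ / 2`.
* **The local zeta integral** `placesZeta T μG Ψ φ s = ∫_{G_T} Ψ(a) ⟪φ, R(a) φ⟫ |det a|_𝔸^s da`: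
  absolutely convergent for every `s` (`integrable_norm_mul_adelicAbsDet_rpow`, hypothesis `hΦG`),
  entire (`differentiable_placesZeta`, differentiation under the integral sign, Mathlib
  `hasDerivAt_integral_of_dominated_loc_of_deriv_le`) and with `Re Z_T(σ) > 0` for real `σ`
  (`re_placesZeta_pos`: the real part of the integrand is continuous, compactly supported, `≥ 0` and
  `> 0` at `a = 1`; Haar measure charges opens) — the entire, non-vanishing "ramified × archimedean"
  factor of Godement–Jacquet's Thm. 13.8 (there obtained from Thms. 3.3 and 8.7 place by place; here
  for the specific test vector, without the tensor-product theorem).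

No named facts are introduced. The consumer is `GodementJacquetZetaIntegralsProofs`
(`GodementJacquet1972_gjZeta_eulerFactorisation_holds`).

References: R. Godement, H. Jacquet, *Zeta functions of simple algebras*, LNM 260 (1972), Thm. 3.3,
Thm. 8.7, §§10–13 (Thm. 13.8 and its proof); H. Jacquet, *Principal L-functions of the linear
group*, Proc. Symp. Pure Math. 33.2 (1979), §§1, 6; A. Weil, *Basic Number Theory*, Ch. IV §1
(neighbourhood bases of adele groups).
-/

noncomputable section

open scoped MatrixGroups NNReal Topology Classical InnerProductSpace
open NumberField NumberField.mixedEmbedding IsDedekindDomain MeasureTheory Filter Topology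

namespace Literature.NumberTheory.Automorphic

/-! ### Neighbourhoods of `1` in `GL_n(𝔸_K)` of product form -/

section Nhds

variable (n : ℕ) (K : Type) [Field K] [NumberField K]

/-- The archimedean coordinates of `g ∈ GL_n(𝔸_K)` (`adelicMatrixArch` of its matrix) are the
entries of `GLn.toMixed g` (definitional). [folklore] -/
theorem adelicMatrixArch_coe (g : GL (Fin n) (AdeleRing (𝓞 K) K)) :
    adelicMatrixArch n K (g : Matrix (Fin n) (Fin n) (AdeleRing (𝓞 K) K)) =
      ((GLn.toMixed n K g : GL (Fin n) (mixedSpace K)) : Matrix (Fin n) (Fin n) (mixedSpace K)) :=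
  rfl

/-- **Matrix inversion is continuous on the invertible matrices of `M_n(ℝ^{r₁} × ℂ^{r₂})`**
(`A⁻¹ = (det A)⁻¹ • adj A`; `Ring.inverse` is continuous at the units of the complete normed ring
`mixedSpace K`). [folklore] -/
theorem continuousOn_matrix_inv_mixedSpace :
    ContinuousOn (fun A : Matrix (Fin n) (Fin n) (mixedSpace K) => A⁻¹) {A | IsUnit A} := by
  intro A hA
  have hdet : IsUnit A.det := (Matrix.isUnit_iff_isUnit_det A).1 hA
  refine ContinuousAt.continuousWithinAt ?_
  change ContinuousAt (fun A : Matrix (Fin n) (Fin n) (mixedSpace K) => Ring.inverse A.det • A.adjugate) A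
  obtain ⟨u, hu⟩ := hdet
  have h1 : ContinuousAt Ring.inverse A.det := by rw [← hu]; exact NormedRing.inverse_continuousAt u
  have h2 : ContinuousAt (fun B : Matrix (Fin n) (Fin n) (mixedSpace K) => Ring.inverse B.det) A :=
    h1.comp ((continuous_id (X := Matrix (Fin n) (Fin n) (mixedSpace K))).matrix_det.continuousAt)
  exact h2.smul ((continuous_id (X := Matrix (Fin n) (Fin n) (mixedSpace K))).matrix_adjugate.continuousAt)

/-- The units topology of `GL_n(ℝ^{r₁} × ℂ^{r₂})` is the topology induced from `M_n` (Mathlib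
`Units.isEmbedding_val_mk'` with the continuity of inversion). [folklore] -/
theorem isEmbedding_val_generalLinearGroup_mixedSpace :
    IsEmbedding (Units.val : GL (Fin n) (mixedSpace K) → Matrix (Fin n) (Fin n) (mixedSpace K)) :=
  Units.isEmbedding_val_mk' (continuousOn_matrix_inv_mixedSpace n K) fun u => (Matrix.coe_units_inv u).symm

/-- **Small archimedean matrices map into any neighbourhood of `1` in `GL_n(𝔸_K)`**: there is an
open `V ∋ 1` in `M_n(ℝ^{r₁} × ℂ^{r₂})` with `ofInfinite g ∈ U` whenever `g ∈ V`. [folklore] -/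
theorem exists_isOpen_subset_preimage_ofInfinite {U : Set (GL (Fin n) (AdeleRing (𝓞 K) K))}
    (hU : U ∈ 𝓝 (1 : GL (Fin n) (AdeleRing (𝓞 K) K))) :
    ∃ V : Set (Matrix (Fin n) (Fin n) (mixedSpace K)), IsOpen V ∧ (1 : Matrix (Fin n) (Fin n) (mixedSpace K)) ∈ V ∧
      ∀ g : GL (Fin n) (mixedSpace K), (g : Matrix (Fin n) (Fin n) (mixedSpace K)) ∈ V → GLn.ofInfinite n K g ∈ U := by
  have h1 : GLn.ofInfinite n K ⁻¹' U ∈ 𝓝 (1 : GL (Fin n) (mixedSpace K)) := by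
    refine (GLn.continuous_ofInfinite n K).continuousAt.preimage_mem_nhds ?_
    rwa [map_one]
  rw [(isEmbedding_val_generalLinearGroup_mixedSpace n K).nhds_eq_comap, Filter.mem_comap] at h1
  obtain ⟨W, hW, hWU⟩ := h1
  rw [Units.val_one] at hW
  obtain ⟨V, hVW, hV, h1V⟩ := mem_nhds_iff.1 hW
  exact ⟨V, hV, h1V, fun g hg => hWU (hVW hg)⟩

/-- **Product neighbourhoods of `1` in `GL_n(𝔸_K)`.** Every neighbourhood `U` of `1` contains all
`g` whose archimedean matrix `g_∞` lies in a suitable open `V ∋ 1` of `M_n(ℝ^{r₁} × ℂ^{r₂})` and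
whose finite component lies in a suitable principal congruence subgroup `K(𝔫)`, `𝔫 ≠ 0`
(continuity of multiplication, `g = (g_∞, 1) (1, g_f)`, `exists_isOpen_subset_preimage_ofInfinite`,
`exists_principalCongruenceLevel_subset`). [folklore] -/
theorem exists_isOpen_level_subset {U : Set (GL (Fin n) (AdeleRing (𝓞 K) K))}
    (hU : U ∈ 𝓝 (1 : GL (Fin n) (AdeleRing (𝓞 K) K))) :
    ∃ V : Set (Matrix (Fin n) (Fin n) (mixedSpace K)), IsOpen V ∧ (1 : Matrix (Fin n) (Fin n) (mixedSpace K)) ∈ V ∧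
      ∃ 𝔫 : Ideal (𝓞 K), 𝔫 ≠ 0 ∧ ∀ g : GL (Fin n) (AdeleRing (𝓞 K) K),
        ((GLn.toMixed n K g : GL (Fin n) (mixedSpace K)) : Matrix (Fin n) (Fin n) (mixedSpace K)) ∈ V →
          GLn.ofFinite n K (GLn.sndHom n K g) ∈ principalCongruenceLevel n K 𝔫 → g ∈ U := by
  obtain ⟨W, hW, hWU⟩ : ∃ W ∈ 𝓝 (1 : GL (Fin n) (AdeleRing (𝓞 K) K)), ∀ a ∈ W, ∀ b ∈ W, a * b ∈ U :=
    exists_nhds_one_split hU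
  have hU₁ : W ∈ 𝓝 (1 : GL (Fin n) (AdeleRing (𝓞 K) K)) := hW
  have hU₂ : W ∈ 𝓝 (1 : GL (Fin n) (AdeleRing (𝓞 K) K)) := hW
  obtain ⟨V, hV, h1V, hVU⟩ := exists_isOpen_subset_preimage_ofInfinite n K hU₁
  obtain ⟨𝔫, h𝔫, h𝔫U⟩ := exists_principalCongruenceLevel_subset (n := n) (K := K) hU₂
  refine ⟨V, hV, h1V, 𝔫, h𝔫, fun g hg hgf => ?_⟩
  have hg' : g = GLn.ofInfinite n K (GLn.toMixed n K g) * GLn.ofFinite n K (GLn.sndHom n K g) :=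
    (GLn.ofInfinite_toMixed_mul_ofFinite_sndHom g).symm
  rw [hg']
  exact hWU _ (hVU _ hg) _ (h𝔫U hgf)

end Nhds

/-! ### The finite test function: the indicator of a congruence box in `M_n(𝔸_K^∞)` -/

section FiniteBox

variable (n : ℕ) (K : Type) [Field K] [NumberField K]

/-- Closed valuation balls in `K_w` are closed. [folklore] -/
theorem isClosed_setOf_valued_le (w : HeightOneSpectrum (𝓞 K)) (r : WithZero (Multiplicative ℤ)) :
    IsClosed {y : w.adicCompletion K | Valued.v y ≤ r} := by
  by_cases hr : r = 0
  · have h : {y : w.adicCompletion K | Valued.v y ≤ r} = {0} := by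
      ext y; simp [hr]
    rw [h]; exact isClosed_singleton
  · -- the complement `{v y > r} = {v y ≥ r'}`-type set is open: use clopen balls
    have h1 : IsOpen {y : w.adicCompletion K | Valued.v y ≤ r}ᶜ := by
      rw [isOpen_iff_mem_nhds]
      intro y hy
      rw [Set.mem_compl_iff, Set.mem_setOf_eq, not_le] at hy
      have hy0 : Valued.v y ≠ 0 := ne_of_gt (lt_of_le_of_lt zero_le hy)
      have hopen := isOpen_setOf_valued_le w hy0
      -- the sphere through `y` is a neighbourhood on which the valuation is constant
      have hmem : {z : w.adicCompletion K | Valued.v (z - y) < Valued.v y} ∈ 𝓝 y := by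
        have hc : Continuous fun z : w.adicCompletion K => z - y := continuous_id.sub continuous_const
        have ho : IsOpen {u : w.adicCompletion K | Valued.v u < Valued.v y} := by
          obtain ⟨z, hz⟩ := w.valuation_surjective K (Valued.v y)
          have hz' : Valued.v (z : w.adicCompletion K) = Valued.v y := by
            rw [HeightOneSpectrum.valuedAdicCompletion_eq_valuation', hz]
          have h := Valued.isOpen_ball (w.adicCompletion K) (Valued.v.restrict (z : w.adicCompletion K))
          simp only [Valuation.restrict_lt_iff, hz'] at h
          exact h
        refine (ho.preimage hc).mem_nhds ?_
        simp only [Set.mem_preimage, Set.mem_setOf_eq, sub_self, map_zero]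
        exact lt_of_le_of_ne zero_le hy0.symm
      refine Filter.mem_of_superset hmem fun z hz => ?_
      rw [Set.mem_setOf_eq] at hz
      rw [Set.mem_compl_iff, Set.mem_setOf_eq, not_le]
      have : Valued.v z = Valued.v y := by
        have e : z = z - y + y := by ring
        rw [e]
        exact Valuation.map_add_eq_of_lt_right _ hz
      rw [this]; exact hy
    exact ⟨h1⟩

variable {n K}

/-- The **congruence box** `B(𝔫) ⊆ M_n(𝔸_K^∞)`: matrices with integral entries everywhere and
congruent to `1` modulo `𝔫`, `y_{ij,w} ∈ 𝒪_w`, `|y_{ij,w} - δ_{ij}|_w ≤ |𝔫|_w`; i.e.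
`∏_{w ∣ 𝔫} (1 + 𝔫 M_n(𝒪_w)) × ∏_{w ∤ 𝔫} M_n(𝒪_w)`. [folklore] -/
def finiteBox (n : ℕ) (K : Type) [Field K] [NumberField K] (𝔫 : Ideal (𝓞 K)) :
    Set (Matrix (Fin n) (Fin n) (FiniteAdeleRing (𝓞 K) K)) :=
  {y | ∀ (w : HeightOneSpectrum (𝓞 K)) (i j : Fin n), Valued.v ((y i j) w) ≤ 1 ∧
    Valued.v ((y i j) w - (1 : Matrix (Fin n) (Fin n) (w.adicCompletion K)) i j) ≤ idealRadius K w 𝔫}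

/-- Membership in the congruence box (definitional). [folklore] -/
theorem mem_finiteBox_iff {𝔫 : Ideal (𝓞 K)} {y : Matrix (Fin n) (Fin n) (FiniteAdeleRing (𝓞 K) K)} :
    y ∈ finiteBox n K 𝔫 ↔ ∀ (w : HeightOneSpectrum (𝓞 K)) (i j : Fin n), Valued.v ((y i j) w) ≤ 1 ∧
      Valued.v ((y i j) w - (1 : Matrix (Fin n) (Fin n) (w.adicCompletion K)) i j) ≤ idealRadius K w 𝔫 :=
  Iff.rfl

/-- `idealRadius` is never zero. [folklore] -/
theorem idealRadius_ne_zero (w : HeightOneSpectrum (𝓞 K)) (𝔫 : Ideal (𝓞 K)) : idealRadius K w 𝔫 ≠ 0 := by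
  rw [idealRadius]; exact WithZero.coe_ne_zero

/-- The identity entries `δ_{ij} ∈ K_w` have valuation `≤ 1`. [folklore] -/
theorem valued_one_apply_le_one (w : HeightOneSpectrum (𝓞 K)) (i j : Fin n) :
    Valued.v ((1 : Matrix (Fin n) (Fin n) (w.adicCompletion K)) i j) ≤ 1 := by
  rw [Matrix.one_apply]
  split_ifs
  · rw [map_one]
  · rw [map_zero]; exact zero_le

/-- At `w ∤ 𝔫` the congruence condition of `finiteBox` is implied by integrality. [folklore] -/
theorem valued_sub_one_le_idealRadius_of_not_dvd {𝔫 : Ideal (𝓞 K)} (h𝔫 : 𝔫 ≠ 0) {w : HeightOneSpectrum (𝓞 K)}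
    (hw : ¬ w.asIdeal ∣ 𝔫) {y : w.adicCompletion K} (hy : Valued.v y ≤ 1) (i j : Fin n) :
    Valued.v (y - (1 : Matrix (Fin n) (Fin n) (w.adicCompletion K)) i j) ≤ idealRadius K w 𝔫 := by
  rw [idealRadius_eq_one_of_not_dvd h𝔫 hw]
  exact (Valuation.map_sub _ _ _).trans (max_le hy (valued_one_apply_le_one w i j))

/-- **The congruence box is open** (`M_n(𝒪̂)` is open and the congruence conditions at the
finitely many `w ∣ 𝔫` are open). [folklore] -/
theorem isOpen_finiteBox {𝔫 : Ideal (𝓞 K)} (h𝔫 : 𝔫 ≠ 0) : IsOpen (finiteBox n K 𝔫) := by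
  have hfin := Ideal.finite_factors h𝔫
  -- entrywise description
  have h : finiteBox n K 𝔫 = ⋂ i : Fin n, ⋂ j : Fin n,
      ((fun y : Matrix (Fin n) (Fin n) (FiniteAdeleRing (𝓞 K) K) => y i j) ⁻¹'
        ((integralFiniteAdeles K : Set (FiniteAdeleRing (𝓞 K) K)) ∩
          ⋂ w ∈ {w : HeightOneSpectrum (𝓞 K) | w.asIdeal ∣ 𝔫},
            {z | Valued.v (z w - (1 : Matrix (Fin n) (Fin n) (w.adicCompletion K)) i j) ≤ idealRadius K w 𝔫})) := by
    ext y
    simp only [mem_finiteBox_iff, Set.mem_iInter, Set.mem_preimage, Set.mem_inter_iff, SetLike.mem_coe,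
      mem_integralFiniteAdeles_iff, HeightOneSpectrum.mem_adicCompletionIntegers, Set.mem_setOf_eq]
    constructor
    · intro H i j
      exact ⟨fun w => (H w i j).1, fun w _ => (H w i j).2⟩
    · intro H w i j
      refine ⟨(H i j).1 w, ?_⟩
      by_cases hw : w.asIdeal ∣ 𝔫
      · exact (H i j).2 w hw
      · exact valued_sub_one_le_idealRadius_of_not_dvd h𝔫 hw ((H i j).1 w) i j
  rw [h]
  refine isOpen_iInter_of_finite fun i => isOpen_iInter_of_finite fun j => ?_
  refine IsOpen.preimage (continuous_id.matrix_elem i j) ((isOpen_integralFiniteAdeles K).inter ?_)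
  refine hfin.isOpen_biInter fun w _ => ?_
  exact (isOpen_setOf_valued_le w (idealRadius_ne_zero w 𝔫)).preimage
    ((RestrictedProduct.continuous_eval w).sub continuous_const)

/-- The congruence box is closed. [folklore] -/
theorem isClosed_finiteBox (𝔫 : Ideal (𝓞 K)) : IsClosed (finiteBox n K 𝔫) := by
  have h : finiteBox n K 𝔫 = ⋂ w : HeightOneSpectrum (𝓞 K), ⋂ i : Fin n, ⋂ j : Fin n,
      ({y : Matrix (Fin n) (Fin n) (FiniteAdeleRing (𝓞 K) K) | Valued.v ((y i j) w) ≤ 1} ∩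
        {y | Valued.v ((y i j) w - (1 : Matrix (Fin n) (Fin n) (w.adicCompletion K)) i j) ≤ idealRadius K w 𝔫}) := by
    ext y; simp [mem_finiteBox_iff]
  rw [h]
  refine isClosed_iInter fun w => isClosed_iInter fun i => isClosed_iInter fun j => IsClosed.inter ?_ ?_
  · exact (isClosed_setOf_valued_le K w 1).preimage ((RestrictedProduct.continuous_eval w).comp (continuous_id.matrix_elem i j))
  · exact (isClosed_setOf_valued_le K w _).preimage
      (((RestrictedProduct.continuous_eval w).comp (continuous_id.matrix_elem i j)).sub continuous_const)

/-- The congruence box is compact (closed in the compact `M_n(𝒪̂)`). [folklore] -/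
theorem isCompact_finiteBox (𝔫 : Ideal (𝓞 K)) : IsCompact (finiteBox n K 𝔫) := by
  have hcpt : IsCompact (X := Matrix (Fin n) (Fin n) (FiniteAdeleRing (𝓞 K) K))
      (Set.pi Set.univ fun _ : Fin n => Set.pi Set.univ fun _ : Fin n =>
        (integralFiniteAdeles K : Set (FiniteAdeleRing (𝓞 K) K))) :=
    isCompact_univ_pi fun _ => isCompact_univ_pi fun _ => isCompact_integralFiniteAdeles K
  refine hcpt.of_isClosed_subset (isClosed_finiteBox 𝔫) fun y hy => ?_
  change (fun i j => y i j : Fin n → Fin n → FiniteAdeleRing (𝓞 K) K) ∈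
    Set.pi Set.univ fun _ : Fin n => Set.pi Set.univ fun _ : Fin n => (integralFiniteAdeles K : Set (FiniteAdeleRing (𝓞 K) K))
  simp only [Set.mem_pi, Set.mem_univ, true_implies, SetLike.mem_coe, mem_integralFiniteAdeles_iff,
    HeightOneSpectrum.mem_adicCompletionIntegers]
  exact fun i j w => (hy w i j).1

/-- **The indicator of the congruence box is a Schwartz–Bruhat function** on `M_n(𝔸_K^∞)` (locally
constant: the box is clopen; compactly supported: the box is compact). [folklore] -/
theorem indicator_finiteBox_mem_schwartzBruhat {𝔫 : Ideal (𝓞 K)} (h𝔫 : 𝔫 ≠ 0) :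
    (finiteBox n K 𝔫).indicator (fun _ => (1 : ℂ)) ∈ SchwartzBruhat (Matrix (Fin n) (Fin n) (FiniteAdeleRing (𝓞 K) K)) := by
  rw [mem_schwartzBruhat_iff]
  constructor
  · rw [IsLocallyConstant.iff_exists_open]
    intro y
    by_cases hy : y ∈ finiteBox n K 𝔫
    · exact ⟨finiteBox n K 𝔫, isOpen_finiteBox h𝔫, hy, fun z hz => by
        rw [Set.indicator_of_mem hz, Set.indicator_of_mem hy]⟩
    · exact ⟨(finiteBox n K 𝔫)ᶜ, (isClosed_finiteBox 𝔫).isOpen_compl, hy, fun z hz => by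
        rw [Set.indicator_of_notMem hz, Set.indicator_of_notMem hy]⟩
  · exact HasCompactSupport.intro (isCompact_finiteBox 𝔫) fun y hy => Set.indicator_of_notMem hy _

end FiniteBox

/-! ### Congruence conditions: `1 + 𝔪 M_n(𝒪)` lies in the valued congruence subgroup -/

section Congruence

variable {F : Type*} [Field F] {Γ₀ : Type*} [LinearOrderedCommGroupWithZero Γ₀] [Valued F Γ₀]
  {m : Type*} [Fintype m] [DecidableEq m]

/-- **An integral matrix congruent to `1` modulo a proper ideal is a unit of `M_n(𝒪)` with the same
congruence**: if `|g_{ij}| ≤ 1` and `|(g - 1)_{ij}| ≤ c < 1` then `g⁻¹` is integral too, hence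
`g ∈ valuedCongruenceSubgroup m c`. (Ultrametric maximum argument on `g⁻¹ = 1 + (1 - g) g⁻¹`: the
largest entry `M` of `g⁻¹` satisfies `M ≤ max(1, c M)`, impossible for `M > 1`.) [folklore] -/
theorem mem_valuedCongruenceSubgroup_of_valued_le {g : GL m F} {c : Γ₀} (hc : c < 1)
    (h1 : ∀ i j, Valued.v ((g : Matrix m m F) i j) ≤ 1)
    (h2 : ∀ i j, Valued.v (((g : Matrix m m F) - 1) i j) ≤ c) :
    g ∈ valuedCongruenceSubgroup m c := by
  rw [mem_valuedCongruenceSubgroup_iff]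
  refine ⟨h1, ?_, h2⟩
  set b : Matrix m m F := ((g⁻¹ : GL m F) : Matrix m m F) with hb
  -- `b = 1 + (1 - g) b`
  have hrel : b = 1 + (1 - (g : Matrix m m F)) * b := by
    rw [sub_mul, one_mul, hb, ← Units.val_mul, mul_inv_cancel, Units.val_one]
    abel
  by_contra hcon
  rw [not_forall] at hcon
  obtain ⟨i₁, hi₁⟩ := hcon
  rw [not_forall] at hi₁
  obtain ⟨j₁, hij₁⟩ := hi₁
  -- a maximal entry
  haveI : Nonempty (m × m) := ⟨(i₁, j₁)⟩
  obtain ⟨⟨i₀, j₀⟩, hmax⟩ := Finite.exists_max fun p : m × m => Valued.v (b p.1 p.2)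
  set M := Valued.v (b i₀ j₀) with hM
  have hM1 : 1 < M := lt_of_lt_of_le (not_le.1 hij₁) (hmax (i₁, j₁))
  have hM0 : M ≠ 0 := ne_of_gt (lt_trans zero_lt_one hM1)
  -- estimate the maximal entry through `b = 1 + (1 - g) b`
  have hest : M ≤ max 1 (c * M) := by
    have e : b i₀ j₀ = (1 : Matrix m m F) i₀ j₀ + ∑ k, (1 - (g : Matrix m m F)) i₀ k * b k j₀ := by
      conv_lhs => rw [hrel]
      rw [Matrix.add_apply, Matrix.mul_apply]
    have hone : Valued.v ((1 : Matrix m m F) i₀ j₀) ≤ 1 := by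
      rw [Matrix.one_apply]; split_ifs
      · rw [map_one]
      · rw [map_zero]; exact zero_le
    have hsum : Valued.v (∑ k, (1 - (g : Matrix m m F)) i₀ k * b k j₀) ≤ c * M := by
      refine Valuation.map_sum_le _ fun k _ => ?_
      rw [map_mul]
      have hk : Valued.v ((1 - (g : Matrix m m F)) i₀ k) ≤ c := by
        have := h2 i₀ k
        rwa [← Valuation.map_neg, ← Matrix.neg_apply, neg_sub] at this
      exact mul_le_mul' hk (hmax (k, j₀))
    calc M = Valued.v (b i₀ j₀) := hM
      _ = Valued.v ((1 : Matrix m m F) i₀ j₀ + ∑ k, (1 - (g : Matrix m m F)) i₀ k * b k j₀) := by rw [← e]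
      _ ≤ max (Valued.v ((1 : Matrix m m F) i₀ j₀)) (Valued.v (∑ k, (1 - (g : Matrix m m F)) i₀ k * b k j₀)) :=
          Valuation.map_add _ _ _
      _ ≤ max 1 (c * M) := max_le_max hone hsum
  have hcM : c * M < M := mul_lt_of_lt_one_left (zero_lt_iff.2 hM0) hc
  rcases le_max_iff.1 hest with h | h
  · exact absurd hM1 (not_lt.2 h)
  · exact absurd hcM (not_lt.2 h)

end Congruence

/-! ### The local congruence conditions on `G_T` and the factorisation of the finite test function -/

section Factor

variable {n : ℕ} {K : Type} [Field K] [NumberField K]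

/-- The finite set `T(𝔫)` of primes dividing the non-zero ideal `𝔫`. [folklore] -/
def primesOf {𝔫 : Ideal (𝓞 K)} (h𝔫 : 𝔫 ≠ 0) : Finset (HeightOneSpectrum (𝓞 K)) :=
  (Ideal.finite_factors h𝔫).toFinset

/-- `w ∈ T(𝔫) ↔ w ∣ 𝔫`. [folklore] -/
theorem mem_primesOf_iff {𝔫 : Ideal (𝓞 K)} (h𝔫 : 𝔫 ≠ 0) {w : HeightOneSpectrum (𝓞 K)} :
    w ∈ primesOf h𝔫 ↔ w.asIdeal ∣ 𝔫 := by
  rw [primesOf, Set.Finite.mem_toFinset, Set.mem_setOf_eq]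

/-- `a ∈ GL_n(𝔸_K)` satisfies the **local congruence conditions of level `𝔫`**: at every `w ∣ 𝔫` the
component `a_w` is integral and `≡ 1 (mod 𝔫 𝒪_w)`. [folklore] -/
def InLocalBoxes (𝔫 : Ideal (𝓞 K)) (a : GL (Fin n) (AdeleRing (𝓞 K) K)) : Prop :=
  ∀ w : HeightOneSpectrum (𝓞 K), w.asIdeal ∣ 𝔫 → ∀ i j : Fin n,
    Valued.v (((Matrix.GeneralLinearGroup.map (AdelicGroupData.adeleEval K w) a : GL (Fin n) (w.adicCompletion K)) :
      Matrix (Fin n) (Fin n) (w.adicCompletion K)) i j) ≤ 1 ∧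
    Valued.v (((Matrix.GeneralLinearGroup.map (AdelicGroupData.adeleEval K w) a : GL (Fin n) (w.adicCompletion K)) :
      Matrix (Fin n) (Fin n) (w.adicCompletion K)) i j - (1 : Matrix (Fin n) (Fin n) (w.adicCompletion K)) i j) ≤
        idealRadius K w 𝔫

/-- Entries of the finite part of a product: `((h a)_{ij})_w = (h_w a_w)_{ij}`. [folklore] -/
theorem adelicMatrixFinite_coe_apply (g : GL (Fin n) (AdeleRing (𝓞 K) K)) (w : HeightOneSpectrum (𝓞 K)) (i j : Fin n) :
    (adelicMatrixFinite n K (g : Matrix (Fin n) (Fin n) (AdeleRing (𝓞 K) K)) i j) w =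
      ((Matrix.GeneralLinearGroup.map (AdelicGroupData.adeleEval K w) g : GL (Fin n) (w.adicCompletion K)) :
        Matrix (Fin n) (Fin n) (w.adicCompletion K)) i j := rfl

/-- `|𝔫|_w < 1` at the primes `w ∣ 𝔫` (`𝔫 ≠ 0`). [folklore] -/
theorem idealRadius_lt_one_of_dvd {𝔫 : Ideal (𝓞 K)} (h𝔫 : 𝔫 ≠ 0) {w : HeightOneSpectrum (𝓞 K)}
    (hw : w.asIdeal ∣ 𝔫) : idealRadius K w 𝔫 < 1 := by
  rw [idealRadius, ← WithZero.exp_zero, WithZero.exp_lt_exp, neg_lt_zero, FractionalIdeal.count_coe K w h𝔫, Nat.cast_pos,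
    Nat.pos_iff_ne_zero]
  exact (Associates.count_ne_zero_iff_dvd h𝔫 w.irreducible).2 hw

/-- **Elements of `GL_n(𝔸_K)` satisfying the local congruence conditions have finite part in
`K(𝔫)`**, provided all other finite components are `1` (the case of `a ∈ G_{T(𝔫)}`): the
congruence forces `a_w ∈ 1 + 𝔫 M_n(𝒪_w) ≤ GL_n(𝒪_w)` (`mem_valuedCongruenceSubgroup_of_valued_le`).
[folklore] -/
theorem ofFinite_sndHom_mem_principalCongruenceLevel {𝔫 : Ideal (𝓞 K)} (h𝔫 : 𝔫 ≠ 0)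
    {a : GL (Fin n) (AdeleRing (𝓞 K) K)} (ha : InLocalBoxes 𝔫 a)
    (ha1 : ∀ w : HeightOneSpectrum (𝓞 K), ¬ w.asIdeal ∣ 𝔫 →
      Matrix.GeneralLinearGroup.map (AdelicGroupData.adeleEval K w) a = 1) :
    GLn.ofFinite n K (GLn.sndHom n K a) ∈ principalCongruenceLevel n K 𝔫 := by
  have hloc : ∀ w, Matrix.GeneralLinearGroup.map (AdelicGroupData.adeleEval K w) a ∈
      valuedCongruenceSubgroup (Fin n) (idealRadius K w 𝔫) := by
    intro w
    by_cases hw : w.asIdeal ∣ 𝔫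
    · exact mem_valuedCongruenceSubgroup_of_valued_le (idealRadius_lt_one_of_dvd h𝔫 hw)
        (fun i j => (ha w hw i j).1) (fun i j => by rw [Matrix.sub_apply]; exact (ha w hw i j).2)
    · rw [ha1 w hw, idealRadius_eq_one_of_not_dvd h𝔫 hw]
      exact one_mem _
  -- local components of `(1, a_f)` are those of `a`
  have hcomp : ∀ w, Matrix.GeneralLinearGroup.map (AdelicGroupData.adeleEval K w) (GLn.ofFinite n K (GLn.sndHom n K a)) =
      Matrix.GeneralLinearGroup.map (AdelicGroupData.adeleEval K w) a := by
    intro w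
    refine Matrix.GeneralLinearGroup.ext fun i j => ?_
    rw [AdelicGroupData.coe_map_adeleEval_apply, AdelicGroupData.coe_map_adeleEval_apply, GLn.coe_ofFinite_apply]
    rfl
  rw [mem_principalCongruenceLevel_iff]
  refine ⟨?_, fun w => ?_⟩
  · rw [mem_glIntegralLevel_iff_forall_map (GLn.fstHom_ofFinite _)]
    intro w
    rw [hcomp, glInt_adicCompletion_eq]
    exact valuedCongruenceSubgroup_mono (Fin n) (idealRadius_le_one K w 𝔫) (hloc w)
  · change Matrix.GeneralLinearGroup.map (AdelicGroupData.adeleEval K w) (GLn.ofFinite n K (GLn.sndHom n K a)) ∈ _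
    rw [hcomp]
    exact hloc w

/-- **Factorisation of the finite test function along `GL_n(𝔸_K) = H^T · G_T`**, `T = T(𝔫)`: for
`h ∈ H^T`, `a ∈ G_T`, the finite part of `h a` lies in the congruence box `B(𝔫)` iff `h` is
integral away from `T` and `a` satisfies the local congruence conditions at the primes of `𝔫`
(the components of `h a` are `a_w` at `w ∈ T` and `h_w` at `w ∉ T`). [folklore] -/
theorem adelicMatrixFinite_mul_mem_finiteBox_iff {𝔫 : Ideal (𝓞 K)} (h𝔫 : 𝔫 ≠ 0)
    (h : awayFactor K n (primesOf h𝔫)) (a : placesFactor K n (primesOf h𝔫)) :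
    (adelicMatrixFinite n K ((h : GL (Fin n) (AdeleRing (𝓞 K) K)) * (a : GL (Fin n) (AdeleRing (𝓞 K) K)) : GL (Fin n) (AdeleRing (𝓞 K) K)) ∈ finiteBox n K 𝔫) ↔
      (IsIntegralAway h ∧ InLocalBoxes 𝔫 (a : GL (Fin n) (AdeleRing (𝓞 K) K))) := by
  have hhT : ∀ w, w.asIdeal ∣ 𝔫 → toLocalAway K n (primesOf h𝔫) w h = 1 := fun w hw =>
    toLocalAway_eq_one_of_mem ((mem_primesOf_iff h𝔫).2 hw) h
  have haT : ∀ w, ¬ w.asIdeal ∣ 𝔫 → Matrix.GeneralLinearGroup.map (AdelicGroupData.adeleEval K w)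
      (a : GL (Fin n) (AdeleRing (𝓞 K) K)) = 1 := fun w hw =>
    (mem_range_truncGL_one_sub_adeleAwayIdem_iff n (primesOf h𝔫) a.1).1 a.2 w (mt (mem_primesOf_iff h𝔫).1 hw)
  have hentry : ∀ w i j, (adelicMatrixFinite n K ((h : GL (Fin n) (AdeleRing (𝓞 K) K)) *
      (a : GL (Fin n) (AdeleRing (𝓞 K) K)) : GL (Fin n) (AdeleRing (𝓞 K) K)) i j) w =
        ((Matrix.GeneralLinearGroup.map (AdelicGroupData.adeleEval K w) (h : GL (Fin n) (AdeleRing (𝓞 K) K)) *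
          Matrix.GeneralLinearGroup.map (AdelicGroupData.adeleEval K w) (a : GL (Fin n) (AdeleRing (𝓞 K) K)) :
            GL (Fin n) (w.adicCompletion K)) : Matrix (Fin n) (Fin n) (w.adicCompletion K)) i j := by
    intro w i j
    rw [adelicMatrixFinite_coe_apply, map_mul]
  constructor
  · intro H
    refine ⟨fun w => ?_, fun w hw i j => ?_⟩
    · by_cases hw : w.asIdeal ∣ 𝔫
      · rw [hhT w hw, Units.val_one]; exact IsIntegralMatrix.one
      · intro i j
        have h1 := (H w i j).1
        rw [hentry, haT w hw, mul_one] at h1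
        exact (mem_integer_adicCompletion_iff K w).2 h1
    · have h1 := H w i j
      rw [hentry] at h1
      have e : Matrix.GeneralLinearGroup.map (AdelicGroupData.adeleEval K w) (h : GL (Fin n) (AdeleRing (𝓞 K) K)) = 1 := hhT w hw
      rw [e, one_mul] at h1
      exact h1
  · rintro ⟨Hh, Ha⟩ w i j
    rw [hentry]
    by_cases hw : w.asIdeal ∣ 𝔫
    · have e : Matrix.GeneralLinearGroup.map (AdelicGroupData.adeleEval K w) (h : GL (Fin n) (AdeleRing (𝓞 K) K)) = 1 := hhT w hw
      rw [e, one_mul]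
      exact Ha w hw i j
    · rw [haT w hw, mul_one]
      have hint : Valued.v (((Matrix.GeneralLinearGroup.map (AdelicGroupData.adeleEval K w)
          (h : GL (Fin n) (AdeleRing (𝓞 K) K)) : GL (Fin n) (w.adicCompletion K)) : Matrix (Fin n) (Fin n) (w.adicCompletion K)) i j) ≤ 1 :=
        (mem_integer_adicCompletion_iff K w).1 (Hh w i j)
      exact ⟨hint, valued_sub_one_le_idealRadius_of_not_dvd h𝔫 hw hint i j⟩

end Factor

/-! ### The archimedean bump and the global test function `Φ = Φ_∞ ⊗ 1_{B(𝔫)}` -/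

section TestFunction

variable {n : ℕ} {K : Type} [Field K] [NumberField K]

/-- The local congruence conditions define an open set of `GL_n(𝔸_K)`. [folklore] -/
theorem isOpen_setOf_inLocalBoxes {𝔫 : Ideal (𝓞 K)} (h𝔫 : 𝔫 ≠ 0) :
    IsOpen {a : GL (Fin n) (AdeleRing (𝓞 K) K) | InLocalBoxes 𝔫 a} := by
  have hfin := Ideal.finite_factors h𝔫
  have h : {a : GL (Fin n) (AdeleRing (𝓞 K) K) | InLocalBoxes 𝔫 a} =
      ⋂ w ∈ {w : HeightOneSpectrum (𝓞 K) | w.asIdeal ∣ 𝔫}, ⋂ i : Fin n, ⋂ j : Fin n,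
        {a : GL (Fin n) (AdeleRing (𝓞 K) K) | Valued.v (((a : Matrix (Fin n) (Fin n) (AdeleRing (𝓞 K) K)) i j).2 w) ≤ 1} ∩
        {a : GL (Fin n) (AdeleRing (𝓞 K) K) | Valued.v (((a : Matrix (Fin n) (Fin n) (AdeleRing (𝓞 K) K)) i j).2 w -
          (1 : Matrix (Fin n) (Fin n) (w.adicCompletion K)) i j) ≤ idealRadius K w 𝔫} := by
    ext a
    simp only [Set.mem_setOf_eq, InLocalBoxes, Set.mem_iInter, Set.mem_inter_iff]
    rfl
  rw [h]
  have hc : ∀ (w : HeightOneSpectrum (𝓞 K)) (i j : Fin n), Continuous fun a : GL (Fin n) (AdeleRing (𝓞 K) K) =>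
      ((a : Matrix (Fin n) (Fin n) (AdeleRing (𝓞 K) K)) i j).2 w := fun w i j =>
    (RestrictedProduct.continuous_eval w).comp (continuous_snd.comp (Units.continuous_val.matrix_elem i j))
  refine hfin.isOpen_biInter fun w _ => isOpen_iInter_of_finite fun i => isOpen_iInter_of_finite fun j => ?_
  exact ((isOpen_setOf_valued_le w one_ne_zero).preimage (hc w i j)).inter
    ((isOpen_setOf_valued_le w (idealRadius_ne_zero w 𝔫)).preimage ((hc w i j).sub continuous_const))

/-- The local congruence conditions define a closed set of `GL_n(𝔸_K)`. [folklore] -/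
theorem isClosed_setOf_inLocalBoxes (𝔫 : Ideal (𝓞 K)) :
    IsClosed {a : GL (Fin n) (AdeleRing (𝓞 K) K) | InLocalBoxes 𝔫 a} := by
  have h : {a : GL (Fin n) (AdeleRing (𝓞 K) K) | InLocalBoxes 𝔫 a} =
      ⋂ w : HeightOneSpectrum (𝓞 K), ⋂ (_ : w.asIdeal ∣ 𝔫), ⋂ i : Fin n, ⋂ j : Fin n,
        {a : GL (Fin n) (AdeleRing (𝓞 K) K) | Valued.v (((a : Matrix (Fin n) (Fin n) (AdeleRing (𝓞 K) K)) i j).2 w) ≤ 1} ∩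
        {a : GL (Fin n) (AdeleRing (𝓞 K) K) | Valued.v (((a : Matrix (Fin n) (Fin n) (AdeleRing (𝓞 K) K)) i j).2 w -
          (1 : Matrix (Fin n) (Fin n) (w.adicCompletion K)) i j) ≤ idealRadius K w 𝔫} := by
    ext a
    simp only [Set.mem_setOf_eq, InLocalBoxes, Set.mem_iInter, Set.mem_inter_iff]
    rfl
  rw [h]
  have hc : ∀ (w : HeightOneSpectrum (𝓞 K)) (i j : Fin n), Continuous fun a : GL (Fin n) (AdeleRing (𝓞 K) K) =>
      ((a : Matrix (Fin n) (Fin n) (AdeleRing (𝓞 K) K)) i j).2 w := fun w i j =>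
    (RestrictedProduct.continuous_eval w).comp (continuous_snd.comp (Units.continuous_val.matrix_elem i j))
  refine isClosed_iInter fun w => isClosed_iInter fun _ => isClosed_iInter fun i => isClosed_iInter fun j => ?_
  exact ((isClosed_setOf_valued_le K w 1).preimage (hc w i j)).inter
    ((isClosed_setOf_valued_le K w _).preimage ((hc w i j).sub continuous_const))

/-- `1` satisfies the local congruence conditions. [folklore] -/
theorem inLocalBoxes_one (𝔫 : Ideal (𝓞 K)) : InLocalBoxes 𝔫 (1 : GL (Fin n) (AdeleRing (𝓞 K) K)) := by
  intro w _ i j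
  rw [map_one, Units.val_one, sub_self, map_zero]
  exact ⟨valued_one_apply_le_one w i j, zero_le⟩

variable (n K) in
/-- The archimedean coordinate space `M_n(K_∞) ≅ (Fin n → Fin n → ℝ^{r₁} × ℂ^{r₂})` is the
matrix space `Matrix (Fin n) (Fin n) (mixedSpace K)` (same underlying type; the former carries
Mathlib's sup-norm, used for Schwartz functions). [folklore] -/
theorem adelicMatrixArch_one :
    adelicMatrixArch n K ((1 : GL (Fin n) (AdeleRing (𝓞 K) K)) : Matrix (Fin n) (Fin n) (AdeleRing (𝓞 K) K)) =
      (1 : Matrix (Fin n) (Fin n) (mixedSpace K)) := by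
  rw [adelicMatrixArch_coe, map_one, Units.val_one]

/-- `(h a)_∞ = a_∞` for `h ∈ H^T`. [folklore] -/
theorem adelicMatrixArch_awayFactor_mul {T : Finset (HeightOneSpectrum (𝓞 K))} (h : awayFactor K n T)
    (a : GL (Fin n) (AdeleRing (𝓞 K) K)) :
    adelicMatrixArch n K (((h : GL (Fin n) (AdeleRing (𝓞 K) K)) * a : GL (Fin n) (AdeleRing (𝓞 K) K))) =
      adelicMatrixArch n K (a : Matrix (Fin n) (Fin n) (AdeleRing (𝓞 K) K)) := by
  rw [adelicMatrixArch_coe, adelicMatrixArch_coe, map_mul, GLn.toMixed_apply n K (h : GL (Fin n) (AdeleRing (𝓞 K) K)),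
    fstHom_coe_eq_one, map_one, one_mul]

/-- **The archimedean bump.** For an open `V ∋ 1` of `M_n(ℝ^{r₁} × ℂ^{r₂})` there is a Schwartz
function `Φ_∞` on the real vector space `M_n(K_∞)` (Mathlib `ContDiffBump` around `1`, turned into
a `SchwartzMap` by `HasCompactSupport.toSchwartzMap`) with real values in `[0, 1]`, `Φ_∞(1) = 1` and
`Φ_∞ = 0` off `V`. [folklore] -/
theorem exists_schwartz_bump_mixedSpace {V : Set (Matrix (Fin n) (Fin n) (mixedSpace K))} (hV : IsOpen V)
    (h1 : (1 : Matrix (Fin n) (Fin n) (mixedSpace K)) ∈ V) :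
    ∃ Φinf : SchwartzMap (Fin n → Fin n → mixedSpace K) ℂ,
      (∀ x, ∃ r : ℝ, 0 ≤ r ∧ r ≤ 1 ∧ Φinf x = r) ∧ Φinf (1 : Matrix (Fin n) (Fin n) (mixedSpace K)) = 1 ∧
      ∀ x : Matrix (Fin n) (Fin n) (mixedSpace K), x ∉ V → Φinf x = 0 := by
  have hV' : IsOpen (X := Fin n → Fin n → mixedSpace K) V := hV
  obtain ⟨ε, hε, hεV⟩ := (Metric.isOpen_iff (α := Fin n → Fin n → mixedSpace K)).1 hV'
    ((1 : Matrix (Fin n) (Fin n) (mixedSpace K)) : Fin n → Fin n → mixedSpace K) h1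
  set c₀ : Fin n → Fin n → mixedSpace K := (1 : Matrix (Fin n) (Fin n) (mixedSpace K)) with hc₀
  let f : ContDiffBump c₀ := ⟨ε / 4, ε / 2, by positivity, by linarith⟩
  set F : (Fin n → Fin n → mixedSpace K) → ℝ := ContDiffBump.toFun f with hF
  have hfs : HasCompactSupport fun x => ((F x : ℝ) : ℂ) := f.hasCompactSupport.comp_left Complex.ofReal_zero
  have hfd : ContDiff ℝ (⊤ : ℕ∞) fun x => ((F x : ℝ) : ℂ) := Complex.ofRealCLM.contDiff.comp f.contDiff
  refine ⟨hfs.toSchwartzMap hfd, fun x => ⟨F x, f.nonneg, f.le_one, rfl⟩, ?_, fun x hx => ?_⟩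
  · change ((F c₀ : ℝ) : ℂ) = 1
    rw [hF, f.one_of_mem_closedBall (Metric.mem_closedBall_self (by positivity))]
    simp
  · change ((F x : ℝ) : ℂ) = 0
    rw [hF, f.zero_of_le_dist, Complex.ofReal_zero]
    by_contra hlt
    rw [not_le] at hlt
    exact hx (hεV (Metric.mem_ball.2 (lt_of_lt_of_le hlt (by change ε / 2 ≤ ε; linarith))))

variable (n K) in
/-- The **global test function** `Φ = Φ_∞ ⊗ 1_{B(𝔫)}` on `M_n(𝔸_K)`. [folklore] -/
def gjTestFunction (Φinf : SchwartzMap (Fin n → Fin n → mixedSpace K) ℂ) (𝔫 : Ideal (𝓞 K)) :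
    Matrix (Fin n) (Fin n) (AdeleRing (𝓞 K) K) → ℂ :=
  fun x => Φinf (adelicMatrixArch n K x) * (finiteBox n K 𝔫).indicator (fun _ => (1 : ℂ)) (adelicMatrixFinite n K x)

/-- `Φ ∈ 𝒮(M_n(𝔸_K))` (`tensor_mem_schwartzBruhatAdelicMatrix`). [folklore] -/
theorem gjTestFunction_mem (Φinf : SchwartzMap (Fin n → Fin n → mixedSpace K) ℂ) {𝔫 : Ideal (𝓞 K)} (h𝔫 : 𝔫 ≠ 0) :
    gjTestFunction n K Φinf 𝔫 ∈ schwartzBruhatAdelicMatrix n K :=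
  tensor_mem_schwartzBruhatAdelicMatrix Φinf (indicator_finiteBox_mem_schwartzBruhat h𝔫)

variable (n K) in
/-- The **`G_T`-part of the test function**: `Φ_G(a) = Φ_∞(a_∞) · 1[a_w ≡ 1 mod 𝔫, w ∣ 𝔫]`. [folklore] -/
def gjTestFunctionG (Φinf : SchwartzMap (Fin n → Fin n → mixedSpace K) ℂ) (𝔫 : Ideal (𝓞 K))
    (a : GL (Fin n) (AdeleRing (𝓞 K) K)) : ℂ :=
  Φinf (adelicMatrixArch n K (a : Matrix (Fin n) (Fin n) (AdeleRing (𝓞 K) K))) * (if InLocalBoxes 𝔫 a then 1 else 0)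

/-- **Factorisation `Φ(h a) = 1_{Δ^T}(h) Φ_G(a)`** for `h ∈ H^T`, `a ∈ G_T`, `T = T(𝔫)` — the
hypothesis `hΦ` of `gjZeta_awayProductMeasure_eq`. [folklore] -/
theorem gjTestFunction_mul (Φinf : SchwartzMap (Fin n → Fin n → mixedSpace K) ℂ) {𝔫 : Ideal (𝓞 K)} (h𝔫 : 𝔫 ≠ 0)
    (h : awayFactor K n (primesOf h𝔫)) (a : placesFactor K n (primesOf h𝔫)) :
    gjTestFunction n K Φinf 𝔫 ((h : GL (Fin n) (AdeleRing (𝓞 K) K)) * (a : GL (Fin n) (AdeleRing (𝓞 K) K)) : GL (Fin n) (AdeleRing (𝓞 K) K)) =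
      if IsIntegralAway h then gjTestFunctionG n K Φinf 𝔫 (a : GL (Fin n) (AdeleRing (𝓞 K) K)) else 0 := by
  unfold gjTestFunction gjTestFunctionG
  rw [adelicMatrixArch_awayFactor_mul]
  have hiff := adelicMatrixFinite_mul_mem_finiteBox_iff h𝔫 h a
  by_cases hh : IsIntegralAway h
  · rw [if_pos hh]
    by_cases ha : InLocalBoxes 𝔫 (a : GL (Fin n) (AdeleRing (𝓞 K) K))
    · rw [if_pos ha, Set.indicator_of_mem (hiff.2 ⟨hh, ha⟩)]
    · rw [if_neg ha, Set.indicator_of_notMem (fun hm => ha (hiff.1 hm).2)]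
  · rw [if_neg hh, Set.indicator_of_notMem (fun hm => hh (hiff.1 hm).1), mul_zero]

/-- `Φ` is continuous on `GL_n(𝔸_K)` (the box is clopen). [folklore] -/
theorem continuous_gjTestFunction (Φinf : SchwartzMap (Fin n → Fin n → mixedSpace K) ℂ) {𝔫 : Ideal (𝓞 K)} (h𝔫 : 𝔫 ≠ 0) :
    Continuous fun x : GL (Fin n) (AdeleRing (𝓞 K) K) => gjTestFunction n K Φinf 𝔫 x := by
  unfold gjTestFunction
  have harch : Continuous fun x : GL (Fin n) (AdeleRing (𝓞 K) K) =>
      ((GLn.toMixed n K x : GL (Fin n) (mixedSpace K)) : Matrix (Fin n) (Fin n) (mixedSpace K)) :=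
    Units.continuous_val.comp (GLn.continuous_toMixed n K)
  refine Continuous.mul (Φinf.continuous.comp harch) ?_
  · have hlc := ((mem_schwartzBruhat_iff).1 (indicator_finiteBox_mem_schwartzBruhat (n := n) (K := K) h𝔫)).1
    refine hlc.continuous.comp ?_
    exact (Units.continuous_val.matrix_map continuous_snd)

/-- `|Φ_G(a)| ≤ 1` when `Φ_∞` takes values in `[0,1]`. [folklore] -/
theorem norm_gjTestFunctionG_le {Φinf : SchwartzMap (Fin n → Fin n → mixedSpace K) ℂ}
    (hΦ : ∀ x, ∃ r : ℝ, 0 ≤ r ∧ r ≤ 1 ∧ Φinf x = r) (𝔫 : Ideal (𝓞 K)) (a : GL (Fin n) (AdeleRing (𝓞 K) K)) :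
    ‖gjTestFunctionG n K Φinf 𝔫 a‖ ≤ 1 := by
  unfold gjTestFunctionG
  obtain ⟨r, hr0, hr1, hr⟩ := hΦ (adelicMatrixArch n K (a : Matrix (Fin n) (Fin n) (AdeleRing (𝓞 K) K)))
  rw [hr, norm_mul, Complex.norm_real, Real.norm_of_nonneg hr0]
  split_ifs <;> simp [hr1]

/-- `Φ_G(a)` is real and non-negative. [folklore] -/
theorem exists_gjTestFunctionG_eq {Φinf : SchwartzMap (Fin n → Fin n → mixedSpace K) ℂ}
    (hΦ : ∀ x, ∃ r : ℝ, 0 ≤ r ∧ r ≤ 1 ∧ Φinf x = r) (𝔫 : Ideal (𝓞 K)) (a : GL (Fin n) (AdeleRing (𝓞 K) K)) :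
    ∃ r : ℝ, 0 ≤ r ∧ r ≤ 1 ∧ gjTestFunctionG n K Φinf 𝔫 a = r := by
  unfold gjTestFunctionG
  obtain ⟨r, hr0, hr1, hr⟩ := hΦ (adelicMatrixArch n K (a : Matrix (Fin n) (Fin n) (AdeleRing (𝓞 K) K)))
  by_cases ha : InLocalBoxes 𝔫 a
  · exact ⟨r, hr0, hr1, by rw [hr, if_pos ha, mul_one]⟩
  · exact ⟨0, le_rfl, zero_le_one, by rw [if_neg ha, mul_zero, Complex.ofReal_zero]⟩

/-- `Φ_G(1) = 1` when `Φ_∞(1) = 1`. [folklore] -/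
theorem gjTestFunctionG_one {Φinf : SchwartzMap (Fin n → Fin n → mixedSpace K) ℂ}
    (hΦ1 : Φinf (1 : Matrix (Fin n) (Fin n) (mixedSpace K)) = 1) (𝔫 : Ideal (𝓞 K)) :
    gjTestFunctionG n K Φinf 𝔫 1 = 1 := by
  unfold gjTestFunctionG
  rw [adelicMatrixArch_one, hΦ1, if_pos (inLocalBoxes_one 𝔫), mul_one]

/-- **The support of `Φ_G` on `G_T` is controlled by the product neighbourhood**: if `Φ_∞` vanishes
off `V` and `a ∈ G_{T(𝔫)}` has `Φ_G(a) ≠ 0`, then `a_∞ ∈ V` and `(1, a_f) ∈ K(𝔫)`. [folklore] -/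
theorem gjTestFunctionG_ne_zero_imp {Φinf : SchwartzMap (Fin n → Fin n → mixedSpace K) ℂ}
    {V : Set (Matrix (Fin n) (Fin n) (mixedSpace K))}
    (hΦV : ∀ x : Matrix (Fin n) (Fin n) (mixedSpace K), x ∉ V → Φinf x = 0) {𝔫 : Ideal (𝓞 K)} (h𝔫 : 𝔫 ≠ 0)
    (a : placesFactor K n (primesOf h𝔫)) (ha : gjTestFunctionG n K Φinf 𝔫 (a : GL (Fin n) (AdeleRing (𝓞 K) K)) ≠ 0) :
    ((GLn.toMixed n K (a : GL (Fin n) (AdeleRing (𝓞 K) K)) : GL (Fin n) (mixedSpace K)) : Matrix (Fin n) (Fin n) (mixedSpace K)) ∈ V ∧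
      GLn.ofFinite n K (GLn.sndHom n K (a : GL (Fin n) (AdeleRing (𝓞 K) K))) ∈ principalCongruenceLevel n K 𝔫 := by
  unfold gjTestFunctionG at ha
  have h1 : InLocalBoxes 𝔫 (a : GL (Fin n) (AdeleRing (𝓞 K) K)) := by
    by_contra h; rw [if_neg h, mul_zero] at ha; exact ha rfl
  have h2 : ((GLn.toMixed n K (a : GL (Fin n) (AdeleRing (𝓞 K) K)) : GL (Fin n) (mixedSpace K)) :
      Matrix (Fin n) (Fin n) (mixedSpace K)) ∈ V := by
    by_contra h
    rw [adelicMatrixArch_coe, hΦV _ h, zero_mul] at ha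
    exact ha rfl
  refine ⟨h2, ofFinite_sndHom_mem_principalCongruenceLevel h𝔫 h1 fun w hw => ?_⟩
  exact (mem_range_truncGL_one_sub_adeleAwayIdem_iff n (primesOf h𝔫) a.1).1 a.2 w (mt (mem_primesOf_iff h𝔫).1 hw)

/-- `Φ_G` is continuous on `G_T` (the local congruence conditions are clopen). [folklore] -/
theorem continuous_gjTestFunctionG (Φinf : SchwartzMap (Fin n → Fin n → mixedSpace K) ℂ) {𝔫 : Ideal (𝓞 K)} (h𝔫 : 𝔫 ≠ 0) :
    Continuous fun a : GL (Fin n) (AdeleRing (𝓞 K) K) => gjTestFunctionG n K Φinf 𝔫 a := by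
  unfold gjTestFunctionG
  have harch : Continuous fun x : GL (Fin n) (AdeleRing (𝓞 K) K) =>
      ((GLn.toMixed n K x : GL (Fin n) (mixedSpace K)) : Matrix (Fin n) (Fin n) (mixedSpace K)) :=
    Units.continuous_val.comp (GLn.continuous_toMixed n K)
  refine Continuous.mul (Φinf.continuous.comp harch) ?_
  · have h : (fun a : GL (Fin n) (AdeleRing (𝓞 K) K) => (if InLocalBoxes 𝔫 a then (1 : ℂ) else 0)) =
        {a : GL (Fin n) (AdeleRing (𝓞 K) K) | InLocalBoxes 𝔫 a}.indicator fun _ => (1 : ℂ) := by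
      funext a; by_cases ha : InLocalBoxes 𝔫 a
      · rw [if_pos ha, Set.indicator_of_mem (show a ∈ {a | InLocalBoxes 𝔫 a} from ha)]
      · rw [if_neg ha, Set.indicator_of_notMem (show a ∉ {a | InLocalBoxes 𝔫 a} from ha)]
    rw [h]
    refine IsLocallyConstant.continuous ?_
    rw [IsLocallyConstant.iff_exists_open]
    intro a
    by_cases ha : a ∈ {a : GL (Fin n) (AdeleRing (𝓞 K) K) | InLocalBoxes 𝔫 a}
    · exact ⟨_, isOpen_setOf_inLocalBoxes h𝔫, ha, fun b hb => by
        rw [Set.indicator_of_mem hb, Set.indicator_of_mem ha]⟩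
    · exact ⟨_, (isClosed_setOf_inLocalBoxes 𝔫).isOpen_compl, ha, fun b hb => by
        rw [Set.indicator_of_notMem hb, Set.indicator_of_notMem ha]⟩

end TestFunction

/-! ### Choosing the data: level, places and bump adapted to `φ` -/

section Data

variable {n : ℕ} {K : Type} [Field K] [NumberField K]

/-- `K^T ≤ K(𝔫₀)` when every prime of `𝔫₀` lies in `T`. [folklore] -/
theorem awayLevel_le_principalCongruenceLevel {T : Finset (HeightOneSpectrum (𝓞 K))} {𝔫₀ : Ideal (𝓞 K)}
    (h𝔫₀ : 𝔫₀ ≠ 0) (hT : ∀ w : HeightOneSpectrum (𝓞 K), w.asIdeal ∣ 𝔫₀ → w ∈ T) :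
    awayLevel K n T ≤ principalCongruenceLevel n K 𝔫₀ := by
  intro k hk
  rw [mem_principalCongruenceLevel_iff]
  refine ⟨awayLevel_le_glIntegralLevel n T hk, fun w => ?_⟩
  by_cases hw : w ∈ T
  · have h1 : (AdelicGroupData.gl n K).toLocal w k = 1 :=
      ((mem_range_truncGL_adeleAwayIdem_iff n T k).1 (awayLevel_le_range n T hk)).2 w hw
    rw [h1]; exact one_mem _
  · rw [idealRadius_eq_one_of_not_dvd h𝔫₀ (fun h => hw (hT w h))]
    exact toLocal_mem_valuedCongruenceSubgroup_one (awayLevel_le_glIntegralLevel n T hk) w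

/-- The primes of `𝔫₀ · 𝔫₁ · ∏_{w ∈ S} 𝔭_w` contain `S` and the primes of `𝔫₀`. [folklore] -/
theorem primesOf_mul_prod {𝔫₀ 𝔫₁ : Ideal (𝓞 K)} (h𝔫₀ : 𝔫₀ ≠ 0) (h𝔫₁ : 𝔫₁ ≠ 0) (S : Finset (HeightOneSpectrum (𝓞 K))) :
    ∃ h : 𝔫₀ * 𝔫₁ * ∏ w ∈ S, w.asIdeal ≠ 0,
      S ⊆ primesOf h ∧ (∀ w : HeightOneSpectrum (𝓞 K), w.asIdeal ∣ 𝔫₀ → w ∈ primesOf h) ∧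
      𝔫₀ * 𝔫₁ * ∏ w ∈ S, w.asIdeal ≤ 𝔫₀ ∧ 𝔫₀ * 𝔫₁ * ∏ w ∈ S, w.asIdeal ≤ 𝔫₁ := by
  have hP : ∏ w ∈ S, w.asIdeal ≠ 0 := Finset.prod_ne_zero_iff.2 fun w _ => w.ne_bot
  have h : 𝔫₀ * 𝔫₁ * ∏ w ∈ S, w.asIdeal ≠ 0 := mul_ne_zero (mul_ne_zero h𝔫₀ h𝔫₁) hP
  refine ⟨h, fun w hw => ?_, fun w hw => ?_, ?_, ?_⟩
  · rw [mem_primesOf_iff]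
    exact dvd_mul_of_dvd_right (Finset.dvd_prod_of_mem _ hw) _
  · rw [mem_primesOf_iff]
    exact dvd_mul_of_dvd_left (dvd_mul_of_dvd_left hw _) _
  · rw [mul_assoc]; exact Ideal.mul_le_right
  · rw [mul_comm 𝔫₀ 𝔫₁, mul_assoc]; exact Ideal.mul_le_right

variable {μ : Measure (AdelicGroupData.gl n K).automorphicQuotient}
  [(AdelicGroupData.gl n K).IsAutomorphicMeasure μ]

/-- **The data of the unfolding, adapted to `φ`.** Given `0 ≠ φ` fixed by `K(𝔫₀)` and a finite set
`S` of places, there are a level `𝔫 ≤ 𝔫₀` whose primes `T = T(𝔫)` contain `S` and the primes of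
`𝔫₀` (so `φ` is `K^T`-fixed), an archimedean bump `Φ_∞` (values in `[0,1]`, `Φ_∞(1) = 1`) and a
compact `N ⊆ GL_n(𝔸_K)` such that the `G_T`-part `Φ_G` of the test function vanishes at every
`a ∈ G_T` outside `N` or with `‖R(a) φ - φ‖ ≥ ‖φ‖/2` (`exists_isOpen_level_subset` applied to the
neighbourhood `N ∩ {‖R(g) φ - φ‖ < ‖φ‖/2}` of `1`, strong continuity of `R`). [folklore] -/
theorem exists_unfolding_data (S : Finset (HeightOneSpectrum (𝓞 K))) {φ : (AdelicGroupData.gl n K).L2 μ} (hφ0 : φ ≠ 0)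
    {𝔫₀ : Ideal (𝓞 K)} (h𝔫₀ : 𝔫₀ ≠ 0) :
    ∃ (𝔫 : Ideal (𝓞 K)) (h𝔫 : 𝔫 ≠ 0) (Φinf : SchwartzMap (Fin n → Fin n → mixedSpace K) ℂ)
      (N : Set (GL (Fin n) (AdeleRing (𝓞 K) K))),
      S ⊆ primesOf h𝔫 ∧ (∀ w : HeightOneSpectrum (𝓞 K), w.asIdeal ∣ 𝔫₀ → w ∈ primesOf h𝔫) ∧ 𝔫 ≤ 𝔫₀ ∧
      (∀ x, ∃ r : ℝ, 0 ≤ r ∧ r ≤ 1 ∧ Φinf x = r) ∧ Φinf (1 : Matrix (Fin n) (Fin n) (mixedSpace K)) = 1 ∧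
      IsCompact N ∧
      ∀ a : placesFactor K n (primesOf h𝔫), gjTestFunctionG n K Φinf 𝔫 (a : GL (Fin n) (AdeleRing (𝓞 K) K)) ≠ 0 →
        (a : GL (Fin n) (AdeleRing (𝓞 K) K)) ∈ N ∧
          ‖(AdelicGroupData.gl n K).rightRegular μ (a : GL (Fin n) (AdeleRing (𝓞 K) K)) φ - φ‖ < ‖φ‖ / 2 := by
  haveI : LocallyCompactSpace (GL (Fin n) (AdeleRing (𝓞 K) K)) := AdelicGroupData.locallyCompactSpace_gl_adelic_holds n K
  -- the neighbourhood `U = N ∩ {‖R g φ - φ‖ < ‖φ‖/2}`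
  obtain ⟨N, hN, hN1⟩ := exists_compact_mem_nhds (1 : GL (Fin n) (AdeleRing (𝓞 K) K))
  set U₀ : Set (GL (Fin n) (AdeleRing (𝓞 K) K)) :=
    {g | ‖(AdelicGroupData.gl n K).rightRegular μ g φ - φ‖ < ‖φ‖ / 2} with hU₀
  have hU₀ : U₀ ∈ 𝓝 (1 : GL (Fin n) (AdeleRing (𝓞 K) K)) := by
    have hc : Continuous fun g : GL (Fin n) (AdeleRing (𝓞 K) K) => ‖(AdelicGroupData.gl n K).rightRegular μ g φ - φ‖ :=
      (((AdelicGroupData.gl n K).isStronglyContinuous_rightRegular_holds μ φ).sub continuous_const).norm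
    refine (isOpen_lt hc continuous_const).mem_nhds ?_
    change ‖(AdelicGroupData.gl n K).rightRegular μ (1 : GL (Fin n) (AdeleRing (𝓞 K) K)) φ - φ‖ < ‖φ‖ / 2
    rw [rightRegular_one_apply, sub_self, norm_zero]
    exact half_pos (norm_pos_iff.2 hφ0)
  obtain ⟨V, hV, h1V, 𝔫₁, h𝔫₁, hVU⟩ := exists_isOpen_level_subset n K (Filter.inter_mem hN1 hU₀)
  obtain ⟨Φinf, hΦ01, hΦ1, hΦV⟩ := exists_schwartz_bump_mixedSpace hV h1V
  obtain ⟨h𝔫, hS, hT, hle₀, hle₁⟩ := primesOf_mul_prod h𝔫₀ h𝔫₁ S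
  refine ⟨_, h𝔫, Φinf, N, hS, hT, hle₀, hΦ01, hΦ1, hN, fun a ha => ?_⟩
  obtain ⟨haV, haK⟩ := gjTestFunctionG_ne_zero_imp hΦV h𝔫 a ha
  exact hVU _ haV (principalCongruenceLevel_mono n K h𝔫 hle₁ haK)

end Data

/-! ### The local zeta integral over `G_T`: convergence, analyticity, non-vanishing -/

section LocalZeta

variable {n : ℕ} {K : Type} [Field K] [NumberField K]
  {μ : Measure (AdelicGroupData.gl n K).automorphicQuotient} [(AdelicGroupData.gl n K).IsAutomorphicMeasure μ]
  {T : Finset (HeightOneSpectrum (𝓞 K))}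
  [MeasurableSpace (placesFactor K n T)] [BorelSpace (placesFactor K n T)]
  (μG : Measure (placesFactor K n T)) [μG.IsHaarMeasure]

variable (T) in
/-- The **local zeta integral over `G_T`**: `Z_T(s) = ∫_{G_T} Ψ(a) ⟪φ, R(a) φ⟫ |det a|_𝔸^s da` for a
weight `Ψ` on `GL_n(𝔸_K)` (the `G_T`-part of the test function) and `φ ∈ L²`. [folklore] -/
def placesZeta (Ψ : GL (Fin n) (AdeleRing (𝓞 K) K) → ℂ) (φ : (AdelicGroupData.gl n K).L2 μ) (s : ℂ) : ℂ :=
  ∫ a : placesFactor K n T, Ψ (a : GL (Fin n) (AdeleRing (𝓞 K) K)) *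
    glMatrixCoeff μ φ φ (a : GL (Fin n) (AdeleRing (𝓞 K) K)) *
      ((adelicAbsDet n K (a : GL (Fin n) (AdeleRing (𝓞 K) K)) : ℝ) : ℂ) ^ s ∂μG

omit [MeasurableSpace (placesFactor K n T)] [BorelSpace (placesFactor K n T)] in
/-- A weight supported in a compact subset of `GL_n(𝔸_K)` has compact support on `G_T` (closed
embedding `G_T ↪ GL_n(𝔸_K)`). [folklore] -/
theorem hasCompactSupport_placesFactor {E : Type*} [Zero E] {f : placesFactor K n T → E}
    {N : Set (GL (Fin n) (AdeleRing (𝓞 K) K))} (hN : IsCompact N)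
    (hf : ∀ a : placesFactor K n T, f a ≠ 0 → (a : GL (Fin n) (AdeleRing (𝓞 K) K)) ∈ N) :
    HasCompactSupport f := by
  haveI := t2Space_gl n K
  have hc : IsCompact ((Subtype.val : placesFactor K n T → GL (Fin n) (AdeleRing (𝓞 K) K)) ⁻¹' N) :=
    (isClosed_placesFactor K n T).isClosedEmbedding_subtypeVal.isCompact_preimage hN
  exact HasCompactSupport.intro hc fun a ha => by
    by_contra h
    exact ha (hf a h)

omit [MeasurableSpace (placesFactor K n T)] [BorelSpace (placesFactor K n T)] in
/-- `a ↦ |det a|_𝔸^σ` is continuous on `G_T`. [folklore] -/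
theorem continuous_adelicAbsDet_rpow_placesFactor (σ : ℝ) :
    Continuous fun a : placesFactor K n T => (adelicAbsDet n K (a : GL (Fin n) (AdeleRing (𝓞 K) K)) : ℝ) ^ σ :=
  (continuous_adelicAbsDet.comp continuous_subtype_val).rpow_const fun a =>
    Or.inl (adelicAbsDet_pos (a : GL (Fin n) (AdeleRing (𝓞 K) K))).ne'

/-- **Absolute convergence of the local zeta integral for every `σ`**: `a ↦ |Ψ(a)| |det a|_𝔸^σ` is
integrable on `G_T` when `Ψ` is continuous and supported in a compact set (the hypothesis `hΦG` of
`gjZeta_awayProductMeasure_eq`). [folklore] -/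
theorem integrable_norm_mul_adelicAbsDet_rpow {Ψ : GL (Fin n) (AdeleRing (𝓞 K) K) → ℂ} (hΨc : Continuous Ψ)
    {N : Set (GL (Fin n) (AdeleRing (𝓞 K) K))} (hN : IsCompact N)
    (hΨN : ∀ a : placesFactor K n T, Ψ a ≠ 0 → (a : GL (Fin n) (AdeleRing (𝓞 K) K)) ∈ N) (σ : ℝ) :
    Integrable (fun a : placesFactor K n T =>
      ‖Ψ (a : GL (Fin n) (AdeleRing (𝓞 K) K))‖ * (adelicAbsDet n K (a : GL (Fin n) (AdeleRing (𝓞 K) K)) : ℝ) ^ σ) μG := by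
  refine Continuous.integrable_of_hasCompactSupport ?_ ?_
  · exact ((hΨc.comp continuous_subtype_val).norm).mul (continuous_adelicAbsDet_rpow_placesFactor σ)
  · refine hasCompactSupport_placesFactor hN fun a ha => hΨN a ?_
    intro h; exact ha (by rw [h, norm_zero, zero_mul])

omit [MeasurableSpace (placesFactor K n T)] [BorelSpace (placesFactor K n T)] in
/-- The integrand of `Z_T(s)` is continuous on `G_T`. [folklore] -/
theorem continuous_placesZeta_integrand {Ψ : GL (Fin n) (AdeleRing (𝓞 K) K) → ℂ} (hΨc : Continuous Ψ)
    (φ : (AdelicGroupData.gl n K).L2 μ) (s : ℂ) :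
    Continuous fun a : placesFactor K n T => Ψ (a : GL (Fin n) (AdeleRing (𝓞 K) K)) *
      glMatrixCoeff μ φ φ (a : GL (Fin n) (AdeleRing (𝓞 K) K)) *
        ((adelicAbsDet n K (a : GL (Fin n) (AdeleRing (𝓞 K) K)) : ℝ) : ℂ) ^ s :=
  ((hΨc.comp continuous_subtype_val).mul ((continuous_glMatrixCoeff φ φ).comp continuous_subtype_val)).mul
    ((continuous_adelicAbsDet_cpow s).comp continuous_subtype_val)

/-- `|t^s| ≤ t^{σ₀+1} + t^{σ₀-1}` for `t > 0` and `|s - s₀| < 1`. [folklore] -/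
theorem norm_cpow_le_rpow_add_rpow {t : ℝ} (ht : 0 < t) {s s₀ : ℂ} (hs : s ∈ Metric.ball s₀ 1) :
    ‖(t : ℂ) ^ s‖ ≤ t ^ (s₀.re + 1) + t ^ (s₀.re - 1) := by
  rw [Complex.norm_cpow_eq_rpow_re_of_pos ht]
  have hre : |s.re - s₀.re| < 1 := by
    have h := Metric.mem_ball.1 hs
    rw [Complex.dist_eq] at h
    exact lt_of_le_of_lt (by simpa using Complex.abs_re_le_norm (s - s₀)) h
  rw [abs_lt] at hre
  rcases le_or_gt 1 t with h1 | h1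
  · exact le_add_of_le_of_nonneg (Real.rpow_le_rpow_of_exponent_le h1 (by linarith)) (Real.rpow_nonneg ht.le _)
  · exact le_add_of_nonneg_of_le (Real.rpow_nonneg ht.le _)
      (Real.rpow_le_rpow_of_exponent_ge ht h1.le (by linarith))

/-- **`Z_T` is entire** (differentiation under the integral sign: the integrand is entire in `s`,
continuous and compactly supported in `a`, with derivative `… · log |det a|_𝔸` locally dominated).
[folklore] -/
theorem differentiable_placesZeta {Ψ : GL (Fin n) (AdeleRing (𝓞 K) K) → ℂ} (hΨc : Continuous Ψ)
    {N : Set (GL (Fin n) (AdeleRing (𝓞 K) K))} (hN : IsCompact N)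
    (hΨN : ∀ a : placesFactor K n T, Ψ a ≠ 0 → (a : GL (Fin n) (AdeleRing (𝓞 K) K)) ∈ N)
    (φ : (AdelicGroupData.gl n K).L2 μ) : Differentiable ℂ (placesZeta T μG Ψ φ) := by
  intro s₀
  -- notation
  set d : placesFactor K n T → ℝ := fun a => (adelicAbsDet n K (a : GL (Fin n) (AdeleRing (𝓞 K) K)) : ℝ) with hd
  have hd0 : ∀ a, 0 < d a := fun a => adelicAbsDet_pos _
  have hdc : Continuous d := continuous_adelicAbsDet.comp continuous_subtype_val
  set c : placesFactor K n T → ℂ := fun a => Ψ (a : GL (Fin n) (AdeleRing (𝓞 K) K)) *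
    glMatrixCoeff μ φ φ (a : GL (Fin n) (AdeleRing (𝓞 K) K)) with hc
  have hcc : Continuous c :=
    (hΨc.comp continuous_subtype_val).mul ((continuous_glMatrixCoeff φ φ).comp continuous_subtype_val)
  have hcs : HasCompactSupport c := hasCompactSupport_placesFactor hN fun a ha => hΨN a fun h => ha (by
    simp only [hc, h, zero_mul])
  set F : ℂ → placesFactor K n T → ℂ := fun s a => c a * ((d a : ℝ) : ℂ) ^ s with hF
  set F' : ℂ → placesFactor K n T → ℂ := fun s a => c a * (((d a : ℝ) : ℂ) ^ s * Complex.log (d a)) with hF'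
  have hFc : ∀ s, Continuous (F s) := fun s =>
    hcc.mul ((continuous_adelicAbsDet_cpow s).comp continuous_subtype_val)
  have hlogc : Continuous fun a : placesFactor K n T => Complex.log (d a) := by
    have h : (fun a : placesFactor K n T => Complex.log (d a)) = fun a => ((Real.log (d a) : ℝ) : ℂ) := by
      funext a; rw [Complex.ofReal_log (hd0 a).le]
    rw [h]
    exact Complex.continuous_ofReal.comp (hdc.log fun a => (hd0 a).ne')
  have hF'c : ∀ s, Continuous (F' s) := fun s =>
    hcc.mul (((continuous_adelicAbsDet_cpow s).comp continuous_subtype_val).mul hlogc)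
  -- the dominating function
  set bound : placesFactor K n T → ℝ := fun a => ‖c a‖ * ((d a ^ (s₀.re + 1) + d a ^ (s₀.re - 1)) * ‖Complex.log (d a)‖)
    with hbound
  have hbc : Continuous bound :=
    hcc.norm.mul ((((hdc.rpow_const fun a => Or.inl (hd0 a).ne').add (hdc.rpow_const fun a => Or.inl (hd0 a).ne'))).mul
      hlogc.norm)
  have hbs : HasCompactSupport bound := by
    refine hasCompactSupport_placesFactor hN fun a ha => hΨN a fun h => ha ?_
    simp only [hbound, hc, h, zero_mul, norm_zero]
  have key := hasDerivAt_integral_of_dominated_loc_of_deriv_le (μ := μG) (F := F) (F' := F') (x₀ := s₀)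
    (bound := bound) (Metric.ball_mem_nhds s₀ one_pos)
    (Filter.Eventually.of_forall fun s => (hFc s).aestronglyMeasurable)
    ((hFc s₀).integrable_of_hasCompactSupport (hcs.mul_right))
    (hF'c s₀).aestronglyMeasurable
    (Filter.Eventually.of_forall fun a s hs => by
      simp only [hF', hbound, norm_mul]
      refine mul_le_mul_of_nonneg_left ?_ (norm_nonneg _)
      exact mul_le_mul_of_nonneg_right (norm_cpow_le_rpow_add_rpow (hd0 a) hs) (norm_nonneg _))
    (hbc.integrable_of_hasCompactSupport hbs)
    (Filter.Eventually.of_forall fun a s _ => by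
      simp only [hF, hF']
      have h1 : HasDerivAt (fun s : ℂ => ((d a : ℝ) : ℂ) ^ s) (((d a : ℝ) : ℂ) ^ s * Complex.log (d a) * 1) s :=
        (hasDerivAt_id s).const_cpow (Or.inl (Complex.ofReal_ne_zero.2 (hd0 a).ne'))
      rw [mul_one] at h1
      exact h1.const_mul (c a))
  exact key.2.differentiableAt

/-- **Positivity of the local zeta integral at real points.** If `Ψ` is continuous with values in
`[0, 1]`, `Ψ(1) = 1`, supported in a compact set on which `‖R(a) φ - φ‖ < ‖φ‖ / 2`, and `φ ≠ 0`,
then `Re Z_T(σ) > 0` for every real `σ`: the real part of the integrand is the continuous compactly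
supported function `Ψ(a) |det a|^σ Re ⟪φ, R(a) φ⟫ ≥ 0`, positive at `a = 1`, and Haar measure is
positive on opens. [folklore] -/
theorem re_placesZeta_pos {Ψ : GL (Fin n) (AdeleRing (𝓞 K) K) → ℂ} (hΨc : Continuous Ψ)
    (hΨ01 : ∀ a, ∃ r : ℝ, 0 ≤ r ∧ r ≤ 1 ∧ Ψ a = r) (hΨ1 : Ψ 1 = 1)
    {N : Set (GL (Fin n) (AdeleRing (𝓞 K) K))} (hN : IsCompact N) {φ : (AdelicGroupData.gl n K).L2 μ} (hφ0 : φ ≠ 0)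
    (hsupp : ∀ a : placesFactor K n T, Ψ a ≠ 0 → (a : GL (Fin n) (AdeleRing (𝓞 K) K)) ∈ N ∧
      ‖(AdelicGroupData.gl n K).rightRegular μ (a : GL (Fin n) (AdeleRing (𝓞 K) K)) φ - φ‖ < ‖φ‖ / 2)
    (σ : ℝ) : 0 < (placesZeta T μG Ψ φ σ).re := by
  set d : placesFactor K n T → ℝ := fun a => (adelicAbsDet n K (a : GL (Fin n) (AdeleRing (𝓞 K) K)) : ℝ) with hd
  have hd0 : ∀ a, 0 < d a := fun a => adelicAbsDet_pos _
  -- the real part of the integrand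
  choose r hr0 hr1 hr using hΨ01
  set g : placesFactor K n T → ℝ := fun a => r (a : GL (Fin n) (AdeleRing (𝓞 K) K)) * d a ^ σ *
    (glMatrixCoeff μ φ φ (a : GL (Fin n) (AdeleRing (𝓞 K) K))).re with hg
  have hre : ∀ a : placesFactor K n T, (Ψ (a : GL (Fin n) (AdeleRing (𝓞 K) K)) *
      glMatrixCoeff μ φ φ (a : GL (Fin n) (AdeleRing (𝓞 K) K)) * (((d a : ℝ) : ℂ)) ^ (σ : ℂ)).re = g a := by
    intro a
    rw [hr, ← Complex.ofReal_cpow (hd0 a).le, mul_comm, ← mul_assoc, ← Complex.ofReal_mul, Complex.re_ofReal_mul]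
    simp only [hg]; ring
  have hint : Integrable (fun a : placesFactor K n T => Ψ (a : GL (Fin n) (AdeleRing (𝓞 K) K)) *
      glMatrixCoeff μ φ φ (a : GL (Fin n) (AdeleRing (𝓞 K) K)) * (((d a : ℝ) : ℂ)) ^ (σ : ℂ)) μG := by
    refine (continuous_placesZeta_integrand hΨc φ σ).integrable_of_hasCompactSupport ?_
    refine hasCompactSupport_placesFactor hN fun a ha => (hsupp a fun h => ha ?_).1
    rw [h, zero_mul, zero_mul]
  have hZ : (placesZeta T μG Ψ φ σ).re = ∫ a, g a ∂μG := by
    rw [placesZeta, ← RCLike.re_eq_complex_re, ← integral_re hint]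
    exact integral_congr_ae (Filter.Eventually.of_forall fun a => by rw [RCLike.re_eq_complex_re]; exact hre a)
  rw [hZ]
  -- lower bound for the matrix coefficient on the support
  have hcoeff : ∀ a : placesFactor K n T, Ψ a ≠ 0 →
      ‖φ‖ ^ 2 / 2 < (glMatrixCoeff μ φ φ (a : GL (Fin n) (AdeleRing (𝓞 K) K))).re := by
    intro a ha
    have h := (hsupp a ha).2
    rw [glMatrixCoeff_apply]
    set v := (AdelicGroupData.gl n K).rightRegular μ (a : GL (Fin n) (AdeleRing (𝓞 K) K)) φ with hv
    have e : (⟪φ, v⟫_ℂ).re = ‖φ‖ ^ 2 - (⟪φ, φ - v⟫_ℂ).re := by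
      have e3 : (⟪φ, φ⟫_ℂ).re = ‖φ‖ ^ 2 := by
        have := inner_self_eq_norm_sq (𝕜 := ℂ) φ
        simpa using this
      rw [inner_sub_right, Complex.sub_re, e3]; ring
    rw [e]
    have h1 : (⟪φ, φ - v⟫_ℂ).re ≤ ‖φ‖ * ‖φ - v‖ := (Complex.re_le_norm _).trans (norm_inner_le_norm _ _)
    have h2 : ‖φ - v‖ < ‖φ‖ / 2 := by rwa [norm_sub_rev]
    have hφ : 0 < ‖φ‖ := norm_pos_iff.2 hφ0
    nlinarith
  have hg0 : 0 ≤ g := by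
    intro a
    simp only [hg, Pi.zero_apply]
    by_cases ha : Ψ (a : GL (Fin n) (AdeleRing (𝓞 K) K)) = 0
    · have : r (a : GL (Fin n) (AdeleRing (𝓞 K) K)) = 0 := by
        have h := hr (a : GL (Fin n) (AdeleRing (𝓞 K) K)); rw [ha] at h; exact_mod_cast h.symm
      rw [this, zero_mul, zero_mul]
    · refine mul_nonneg (mul_nonneg (hr0 _) (Real.rpow_nonneg (hd0 a).le _)) ?_
      exact ((div_pos (pow_pos (norm_pos_iff.2 hφ0) 2) two_pos).trans (hcoeff a ha)).le
  have hgc : Continuous g := by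
    have h1 : Continuous fun a : placesFactor K n T => (r (a : GL (Fin n) (AdeleRing (𝓞 K) K)) : ℂ) := by
      have e : (fun a : placesFactor K n T => (r (a : GL (Fin n) (AdeleRing (𝓞 K) K)) : ℂ)) =
          fun a : placesFactor K n T => Ψ (a : GL (Fin n) (AdeleRing (𝓞 K) K)) := funext fun a => (hr _).symm
      rw [e]; exact hΨc.comp continuous_subtype_val
    have h1' : Continuous fun a : placesFactor K n T => r (a : GL (Fin n) (AdeleRing (𝓞 K) K)) := by
      have h2 : Continuous fun a : placesFactor K n T => ((r (a : GL (Fin n) (AdeleRing (𝓞 K) K)) : ℝ) : ℂ).re :=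
        Complex.continuous_re.comp h1
      simpa only [Complex.ofReal_re] using h2
    exact (h1'.mul (continuous_adelicAbsDet_rpow_placesFactor σ)).mul
      (Complex.continuous_re.comp ((continuous_glMatrixCoeff φ φ).comp continuous_subtype_val))
  have hgs : HasCompactSupport g := by
    refine hasCompactSupport_placesFactor hN fun a ha => (hsupp a fun h => ha ?_).1
    have : r (a : GL (Fin n) (AdeleRing (𝓞 K) K)) = 0 := by
      have h' := hr (a : GL (Fin n) (AdeleRing (𝓞 K) K)); rw [h] at h'; exact_mod_cast h'.symm
    simp only [hg, this, zero_mul]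
  have hg1 : g 1 ≠ 0 := by
    have hr1' : r (1 : GL (Fin n) (AdeleRing (𝓞 K) K)) = 1 := by
      have h := hr (1 : GL (Fin n) (AdeleRing (𝓞 K) K))
      rw [hΨ1] at h; exact_mod_cast h.symm
    simp only [hg, OneMemClass.coe_one, hr1', one_mul, glMatrixCoeff_one, inner_self_eq_norm_sq_to_K]
    refine mul_ne_zero (Real.rpow_pos_of_pos (hd0 1) σ).ne' ?_
    norm_cast
    exact (pow_pos (norm_pos_iff.2 hφ0) 2).ne'
  exact hgc.integral_pos_of_hasCompactSupport_nonneg_nonzero hgs hg0 hg1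

end LocalZeta

end Literature.NumberTheory.Automorphic
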